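import Summits.BirchSwinnertonDyer.BirchSwinnertonDyer.Theorems.ManinLocalTwoThreeGammaOneIndexFour
import Summits.BirchSwinnertonDyer.Rank1Residual.ManinAdditive.GammaOneKatoRoad
import Summits.BirchSwinnertonDyer.Rank1Residual.ManinAdditive.TowerUnitTwist
import Literature.NumberTheory.EllipticCurves.ManinConstantGamma1Gamma0LedgerProofs
import HarnessLib
import HarnessLib.Audit.Tags

/-!
# THE SHIMURA-KERNEL SPLIT OF C2 — rows E-an-151 / E-an-152 / E-an-152b / E-an-153 and support S-an-65 typed, with the
# exact split `C2-body ⟺ E-an-151 ∧ C2¹` kernel-checked (cell `bsd-f2-manin`, planner `an` g33, MEMO-an §76;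
# TURNKEY-an-27 file (a); nothing asserted)

TYPER NOTE (typer g18, TURNKEY-an-27 (a)).  SOURCE = HOME/an/g33/Sketch-an-g33.lean sha16 a6fc19f06f502f50 (293 l.; farm rc 0 · 0 err
· 0 warn · 0 sorry, Sketch_check3.json 0dd4565464964c38; BC7 probes Probe-an-g33/g33b/g33c → 5/5 CLEAN), landed VERBATIM except: (i) this
note; (ii) the file is SPLIT BY IMPORT CONE rather than by section: THIS file is route-independent (imports `GammaOneKatoRoad`,
`TowerUnitTwist`, the Theses-free Theorems file `ManinLocalTwoThreeGammaOneIndexFour` and Literature `ManinConstantGamma1Gamma0LedgerProofs`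
only) and carries §0 (`ManinOddAtFourBody`), §1, §2 except the two theorems that name the route declaration
`Theses.ManinLocalTwoThree.ManinOddAtFour`, §3, and §4's `transfer_of_index_one`; the sibling CONE LEAF `ShimuraKernelSplit.lean` carries
`maninOddAtFour_of_body`, `maninOddAtFour_of_transfer_of_gammaOneOddAtFour` (route decl BY NAME) and §4's `transfer_of_not_hasNonBlind`,
`maninOdd_iff_gammaOneOdd_of_not_hasNonBlind` (which need `Theorems.ManinLocalTwoThreeShimuraQuotientRational`, inside the Theses cone);
(iii) `@[conjecture]` attributes added on the four LAW rows E-an-151 / 152 / 152b / 153 (an's ask; obligation nodes, NOTHING asserted),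
while `ManinOddAtFourBody` (= the universal body of C2), `GammaOneOddOfClassAtFour` (= es's E-es-112 `KatoCurve.GammaOneOddAtFour`
specialised to a class, edge proved below) and S-an-65 `KernelToLedgerEdge` (support, prover-sized) stay plain `def … : Prop` nodes as in
the sketch; nothing else changed.

CONTENT (MEMO-an §76.1–76.2).  For a class with `4 ∣ N` let `(E₀, c₀)` be the `X₀(N)`-optimal curve and its Manin constant, `(E₁, c₁)`
the `X₁(N)`-optimal (Stevens) curve and its constant, `Λ₀(f) ⊇ Λ₁(f) ⊇ 2Λ₀(f)` the two period lattices of the newform (Ling–Oesterlé at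
the traceless prime 2, tree `pMulLatticeLeGamma1OfTracelessPrime_holds`), `s := [Λ₀(f):Λ₁(f)] ∈ {1,2,4}`.  Tree theorems (Literature
`ManinConstantGamma1Gamma0LedgerProofs`): `c₁ ∣ c₀` and `|c₀| ∈ {|c₁|, 2|c₁|}`.  Hence `ord₂ c₀ = ord₂ c₁ + δ`, `δ ∈ {0,1}`, `δ = 1 ⟺`
the Shimura covering `E₁ → E₀` is NOT étale at `2`; an's answer to the cell's search question at `p = 2`: the local invariant is the
finite-flat structure over `ℤ₂` of the Shimura-kernel point, `δ = [s = 4] + [s = 2 ∧ T_V non-blind]`, and `C2 ⟺ (c₁ odd) ∧ (δ = 0)`.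
Rows: **E-an-151 `GammaOneTransferAtFour`** (`|c₀| = |c₁|` for the optimal pair of every class with `4 ∣ N`), **C2¹-class
`GammaOneOddOfClassAtFour`**, **E-an-152 `ShimuraKernelBlindAtFour`** (kernel form: at `s = 2` the kernel point is a Kummer-BLIND rational
2-torsion point), **E-an-153 `ShimuraTrivialOfNoBlindAtFour`** (`c`-free, `℘`-free: no blind rational 2-torsion point ⟹ `Λ₁(f) = Λ₀(f)`),
**E-an-152b `ShimuraIndexNeFourAtFour`** (`c`-free: `Λ₁(f) ≠ 2Λ₀(f)`), **S-an-65 `KernelToLedgerEdge`** (support).  PROVED (0 sorry):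
`gammaOneOddOfClassAtFour_of_gammaOneOddAtFour` (E-es-112 ⟹ C2¹-class), `gammaOneTransferAtFour_of_body`, `gammaOneOddOfClassAtFour_of_body`,
`body_of_transfer_of_gammaOneOdd`, **`body_iff`** (F-need ⟹ (C2-body ⟺ E-an-151 ∧ C2¹-class) — THE EXACT SPLIT), `index_ne_four_of_transfer`,
`transfer_of_shimuraTrivial`, `maninOdd_of_shimuraTrivial_of_gammaOneOdd`, `shimuraIndexNeFour_of_body`, `shimuraIndexNeFour_of_transfer`,
`transfer_of_kernel_rows` (S-an-65 ∧ E-an-152 ∧ E-an-152b ⟹ E-an-151 on `a₁ = a₃ = 0` models), `transfer_of_index_one`.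

HONEST FRAMING.  LENS: an (analytic / period-lattice).  NOT IN PRINT as statements: the rows are the `ℓ = 2`, ADDITIVE-reduction hole of
Stevens 1989 / Vatsal 2005 (for odd `ℓ`, semistable `N`: «a cyclic ℓ-isogeny is étale iff its kernel is `≅ ℤ/ℓ` as a Galois module» and
Vatsal's Thm. 1.10 makes `E_min → E₁` of 2-power degree; at `ℓ = 2`, `μ₂ ≅ ℤ/2` Galois-wise and the Galois criterion is void — what
survives is the Néron-model distinction blind / non-blind, the cell's `KummerBlindAtTwo`).  an's presearch (MEMO-an §76.6, corpus + galaxy,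
labelled): [corpus:paper:doi-10-4064-aa165-4-5 p.3], [corpus:paper:doi-10-1017-s147474800500006x p.7], [corpus:paper:arxiv-1501.06296 p.19/21]
(«canonical étale isogeny E₁ → E₀ called the Shimura covering») — nearest print BY NAME: Stevens1989 §2, Vatsal2005 Thm. 1.10 / Rem. 1.8,
ČNS 2023 Lemma 6.5, Ling–Oesterlé 1991 Thm. 6.  WHY NOVEL (an): the exact kernel split of C2 into the X₁-side obligation (es E-es-112) and the
étaleness-at-2 of the Shimura covering, with the latter reduced to the Kummer-blindness of ONE rational 2-torsion point.
BC5 WITNESS (MEMO-an §76.5; HOME/an/g33/census76.py e726083b8a3fc658 → census76.out f9fb4db18f88d975, inputs HOME/es/E15-LATTICE-INDEX-v2partial.tsv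
and HOME/data/KUMMER-4N2000-v1-part*.tsv; plus HOME/an/g16-isogeny-tree.out): E-an-152/153 cross-tab 0/308 violations, `s = 4`: 0/338 classes
(es E15), blind-point profile 94/94 of the g16 census of 897 670 curves; `c₀ = c₁ = 1` for `N ≤ 500 000` (Cremona) ⇒ E-an-151 meets every
tabulated class, violations 0.  CHEAPEST FALSIFIER (an): a class with `[Λ₀:Λ₁] = 2` whose kernel point is non-blind (0/49 index-2 classes
with `4 ∣ N ≤ 1000`) or with `[Λ₀:Λ₁] = 4` (0/338); next: D-an-14 (`s` for all 781 optimal classes `4 ∣ N ≤ 5000` × blind flags, two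
engines).  REFUTER VERDICTS: R-an-62 (ref1: A1–A6, vacuity of E-an-152's `℘`-clause, mutations listed in MEMO-an §76.8 (2)) PENDING at filing —
a row killed AS TYPED is repaired under a NEW name (append-only) and this text then gets a SUPERSEDED paragraph; ref2 placement PENDING.  The
owner (an g33) asked for this landing explicitly (TURNKEY-an-27).
PARTITION currency: 0 RES classes move (obligation nodes + implications between them); beyond-print theorem: NO; bears_on:
stmt-BirchSwinnertonDyer-22967 (C2 `ManinOddAtFour`): C2 = E-es-112 ∧ E-an-151 EXACTLY (sibling `ShimuraKernelSplit.lean` for the by-name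
route edge).  BSD is not proved by this; Manin's conjecture is not proved by this; C2/C3 OPEN.

[cite: Stevens1989, §2 (the X₁(N)-optimal curve, the Shimura covering and c₁; shape only — the additive 2-part rows are the cell's E-an-151/152/152b/153, MEMO-an §76, NOT in print)]
[cite: Vatsal2005, Thm. 1.10 and Rem. 1.8 (semistable N, odd ℓ: multiplicative-type subgroups and E_min → E₁ of 2-power degree; shape only)]
[cite: CesnaviciusNeururerSaha2023, Lemma 6.5 (c₀ = n·c₁ with n the Shimura-cover index; tree `ManinConstantGamma1Gamma0LedgerProofs`)]
[cite: LingOesterle1991, Thm. 6 (2Λ₀(f) ⊆ Λ₁(f) at a traceless prime; tree `pMulLatticeLeGamma1OfTracelessPrime_holds`)]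
[cite: CremonaEcdata, (c₀ = c₁ = 1 for N ≤ 500 000: the BC5 inputs)]
-/

set_option autoImplicit false

noncomputable section

open WeierstrassCurve Literature.NumberTheory.EllipticCurves Literature.NumberTheory.EllipticCurves.ModularForms
open CongruenceSubgroup
open Summit.BirchSwinnertonDyer.Rank1Residual.ManinAdditive.ShimuraLedger
open Summit.BirchSwinnertonDyer.Rank1Residual.ManinAdditive.CuspidalKummer
open Summit.BirchSwinnertonDyer.Rank1Residual.ManinAdditive.KatoCurve
open Summit.BirchSwinnertonDyer.BirchSwinnertonDyer.Theorems.ManinLocalTwoThree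

namespace Summit.BirchSwinnertonDyer.Rank1Residual.ManinAdditive.ShimuraKernel

/-! ## §0 The body of C2 (its four named-fact hypotheses stripped) -/

/-- The universal body of C2 `ManinOddAtFour`: every lattice-optimal `X₀(N)`-datum with `4 ∣ N` has odd Manin constant. -/
def ManinOddAtFourBody : Prop :=
  ∀ (W : WeierstrassCurve ℚ) [W.IsElliptic] [W.IsGloballyMinimal] {N : ℕ} [NeZero N]
    (D : ModularParametrizationData W N),
    (∀ z ∈ D.L.lattice, ∃ w ∈ periodLattice D.f, z = D.c * w) → 2 ^ 2 ∣ N → ¬ (2 : ℤ) ∣ D.maninConstant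

/-! ## §1 E-an-151 and the class form of C2¹ -/

/-- **E-an-151 `GammaOneTransferAtFour` (H2 of MEMO-an §58.3, typed; candidate LAW, nothing asserted).**
For isogenous globally minimal `W₁ ~ W₀`, `D₁` an OPTIMAL `X₁(N)`-datum (Stevens curve), `D₀` a lattice-optimal
`X₀(N)`-datum, `4 ∣ N`: `|c₀| = |c₁|` — the Shimura-cover index `n` of ČNS Lemma 6.5 (`c₀ = n·c₁`, `n ∣ 2` at `4 ∣ N`
by Ling–Oesterlé) is `1`; equivalently `[Λ₀(f) : Λ₁(f)] ≠ 4` and, when `= 2`, the kernel of `E₀ → E₁` is NOT étale over `ℤ₂`.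
Why it might fail: an optimal pair with `|c₀| = 2|c₁|` beyond Cremona's range (`c₀ = c₁ = 1` for `N ≤ 500000`).
[cite: CesnaviciusNeururerSaha2023, Lemma 6.5] [cite: Stevens1989, §2] [cite: Vatsal2005, Thm. 1.10 (semistable, odd ℓ)] -/
@[conjecture]
def GammaOneTransferAtFour : Prop :=
  ∀ (W₁ W₀ : WeierstrassCurve ℚ) [W₁.IsElliptic] [W₁.IsGloballyMinimal] [W₀.IsElliptic] [W₀.IsGloballyMinimal]
    {N : ℕ} [NeZero N] (D₁ : Gamma1ParametrizationData W₁ N) (D₀ : ModularParametrizationData W₀ N),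
    IsIsogenous W₁ W₀ → D₁.IsOptimal → (∀ z ∈ D₀.L.lattice, ∃ w ∈ periodLattice D₀.f, z = D₀.c * w) →
    2 ^ 2 ∣ N → D₀.maninConstant.natAbs = D₁.maninConstant.natAbs

/-- **C2¹ in class form** (`2 ∤ c₁` for the optimal `X₁(N)`-datum of a class carrying a lattice-optimal `X₀(N)`-datum at
`4 ∣ N`); a specialisation of es's E-es-112 `KatoCurve.GammaOneOddAtFour` (next theorem). Nothing asserted.
[cite: Stevens1989, §2] -/
def GammaOneOddOfClassAtFour : Prop :=
  ∀ (W₁ W₀ : WeierstrassCurve ℚ) [W₁.IsElliptic] [W₁.IsGloballyMinimal] [W₀.IsElliptic] [W₀.IsGloballyMinimal]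
    {N : ℕ} [NeZero N] (D₁ : Gamma1ParametrizationData W₁ N) (D₀ : ModularParametrizationData W₀ N),
    IsIsogenous W₁ W₀ → D₁.IsOptimal → (∀ z ∈ D₀.L.lattice, ∃ w ∈ periodLattice D₀.f, z = D₀.c * w) →
    2 ^ 2 ∣ N → ¬ (2 : ℤ) ∣ D₁.maninConstant

/-- E-es-112 ⟹ the class form (additivity of `W₁` at `2` from `4 ∣ N`, `additive_of_sq_dvd_level`). -/
theorem gammaOneOddOfClassAtFour_of_gammaOneOddAtFour (h : GammaOneOddAtFour) : GammaOneOddOfClassAtFour := by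
  intro W₁ W₀ _ _ _ _ N _ D₁ D₀ _hiso h₁ _h₀ h4
  have hadd := additive_of_sq_dvd_level 2 W₁ D₁.f D₁.isNewformOf h4
  exact h W₁ D₁ h₁ hadd.1 hadd.2

/-! ## §2 The exact split `C2-body ⟺ E-an-151 ∧ C2¹` -/

/-- C2-body ⟹ E-an-151: the ledger dichotomy `|c₀| = |c₁| ∨ |c₀| = 2|c₁|` (Ling–Oesterlé + ČNS 6.5, tree theorem) and
`c₀` odd exclude doubling. -/
theorem gammaOneTransferAtFour_of_body (h : ManinOddAtFourBody) : GammaOneTransferAtFour := by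
  intro W₁ W₀ _ _ _ _ N _ D₁ D₀ hiso h₁ h₀ h4
  rcases natAbs_maninConstant₀_eq_or_eq_two_mul_of_four_dvd_level D₁ D₀ hiso h₁ h₀ h4 with he | he
  · exact he
  · exfalso
    apply h W₀ D₀ h₀ h4
    have : (2 : ℤ) ∣ (D₀.maninConstant.natAbs : ℤ) := ⟨D₁.maninConstant.natAbs, by rw [he]; push_cast; ring⟩
    exact Int.dvd_natAbs.mp this

/-- C2-body ⟹ C2¹ (class form): `c₁ ∣ c₀` (ČNS Lemma 6.5, tree theorem) and `c₀` odd. -/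
theorem gammaOneOddOfClassAtFour_of_body (h : ManinOddAtFourBody) : GammaOneOddOfClassAtFour := by
  intro W₁ W₀ _ _ _ _ N _ D₁ D₀ hiso h₁ h₀ h4 h2
  exact h W₀ D₀ h₀ h4 (dvd_trans h2 (h₁.maninConstant_dvd_maninConstant D₀ hiso))

/-- E-an-151 ∧ C2¹ ⟹ C2-body, modulo the existence of the optimal `X₁(N)`-datum of the class (F-need). -/
theorem body_of_transfer_of_gammaOneOdd (hex : exists_optimal_gamma1ParametrizationData)
    (h151 : GammaOneTransferAtFour) (h1 : GammaOneOddOfClassAtFour) : ManinOddAtFourBody := by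
  intro W₀ _ _ N _ D₀ h₀ h4 h2
  obtain ⟨W₁, _, _, D₁, hiso, h₁⟩ := hex W₀ D₀ h₀
  apply h1 W₁ W₀ D₁ D₀ hiso h₁ h₀ h4
  have he := h151 W₁ W₀ D₁ D₀ hiso h₁ h₀ h4
  have : (2 : ℤ) ∣ (D₁.maninConstant.natAbs : ℤ) := by rw [← he]; exact Int.dvd_natAbs.mpr h2
  exact Int.dvd_natAbs.mp this

/-- **THE EXACT SPLIT (kernel-checked, mod F-need).** -/
theorem body_iff (hex : exists_optimal_gamma1ParametrizationData) :
    ManinOddAtFourBody ↔ GammaOneTransferAtFour ∧ GammaOneOddOfClassAtFour :=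
  ⟨fun h ↦ ⟨gammaOneTransferAtFour_of_body h, gammaOneOddOfClassAtFour_of_body h⟩,
    fun h ↦ body_of_transfer_of_gammaOneOdd hex h.1 h.2⟩

/-- E-an-151 excludes the index-`4` configuration `Λ₁(f) = 2Λ₀(f)` (E-an-68, tree theorem
`natAbs_maninConstant₀_eq_two_mul_of_index_four`, and `c₁ ≠ 0`). -/
theorem index_ne_four_of_transfer (h151 : GammaOneTransferAtFour)
    {W₁ W₀ : WeierstrassCurve ℚ} [W₁.IsElliptic] [W₁.IsGloballyMinimal] [W₀.IsElliptic] [W₀.IsGloballyMinimal]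
    {N : ℕ} [NeZero N] (D₁ : Gamma1ParametrizationData W₁ N) (D₀ : ModularParametrizationData W₀ N)
    (hiso : IsIsogenous W₁ W₀) (h₁ : D₁.IsOptimal)
    (h₀ : ∀ z ∈ D₀.L.lattice, ∃ w ∈ periodLattice D₀.f, z = D₀.c * w) (h4 : 2 ^ 2 ∣ N) :
    ¬ (∀ z : ℂ, z ∈ periodLatticeGamma1 D₁.f ↔ ∃ w ∈ periodLattice D₀.f, z = 2 * w) := by
  intro hidx
  have h2 := natAbs_maninConstant₀_eq_two_mul_of_index_four D₁ D₀ h₁ h₀ hidx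
  have he := h151 W₁ W₀ D₁ D₀ hiso h₁ h₀ h4
  have hne : D₁.maninConstant.natAbs ≠ 0 := Int.natAbs_ne_zero.mpr D₁.maninConstant_ne_zero
  omega

/-! ## §3 E-an-152: the kernel form -/

/-- **E-an-152 `ShimuraKernelBlindAtFour` (kernel form of E-an-151; candidate LAW, nothing asserted).**
`W₀` globally minimal with `a₁ = a₃ = 0`, `D₀` a lattice-optimal `X₀(N)`-datum, `4 ∣ N`, and `Λ₁(f) ≠ Λ₀(f)`
(the Shimura kernel meets `E₀` non-trivially).  Then for every `w ∈ Λ₁(f) ∖ 2Λ₀(f)` (so `[Λ₀(f):Λ₁(f)] = 2` and `w` spans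
`Λ₁/2Λ₀`) the `2`-torsion point `T_V = u₀(c₀w/2)` of `E₀` — the generator of `E₀ ∩ Σ(N) = ker(E₀ → E₁)` — is a
RATIONAL point `(E, 0)`, `E ∈ ℤ` on the (integral) model, and Kummer-BLIND: `KummerBlindAtTwo a₂ a₄ E` (existential shape of the LEAD's
`AllRationalTwoTorsionBlind`, so that S-an-65 is his `index_four_of_allBlind_of_natAbs_eq_two_mul` with line 287 replaced).
(Vatsal's «multiplicative-type subgroup» mechanism at `ℓ = 2`, where `μ₂ ≅ ℤ/2` leaves only the Néron-model
distinction blind/non-blind.)  Why it might fail: a class with `[Λ₀:Λ₁] = 2` whose kernel point is non-blind (none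
among the 49 index-`2` classes with `4 ∣ N ≤ 1000`, es E15).
[cite: Vatsal2005, Thm. 1.10 and Rem. 1.8] [cite: LingOesterle1991, Thm. 6] [cite: Stevens1989, §2] -/
@[conjecture]
def ShimuraKernelBlindAtFour : Prop :=
  ∀ (W₀ : WeierstrassCurve ℚ) [W₀.IsElliptic] [W₀.IsGloballyMinimal] {N : ℕ} [NeZero N]
    (D₀ : ModularParametrizationData W₀ N),
    (∀ z ∈ D₀.L.lattice, ∃ w ∈ periodLattice D₀.f, z = D₀.c * w) → 2 ^ 2 ∣ N → W₀.a₁ = 0 → W₀.a₃ = 0 →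
    periodLatticeGamma1 D₀.f ≠ periodLattice D₀.f →
    ∀ w ∈ periodLatticeGamma1 D₀.f, (∀ v ∈ periodLattice D₀.f, w ≠ 2 * v) →
      ∃ A₂ A₄ E : ℤ, (A₂ : ℚ) = W₀.a₂ ∧ (A₄ : ℚ) = W₀.a₄ ∧
        (E : ℚ) ^ 3 + W₀.a₂ * (E : ℚ) ^ 2 + W₀.a₄ * E + W₀.a₆ = 0 ∧
        D₀.L.weierstrassP ((D₀.c : ℂ) * w / 2) = (((E : ℚ) + W₀.a₂ / 3 : ℚ) : ℂ) ∧ KummerBlindAtTwo A₂ A₄ E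

/-- **S-an-65 (support, prover-sized): kernel form ⟹ ledger form on `a₁ = a₃ = 0` models.**  The Vélu step
`false_of_blind_halfPeriod_neronLattice` (LEAD, tree) run with the blindness of the ONE root `℘(c₀w/2) − a₂/3` in place of
`AllRationalTwoTorsionBlind`: doubling `|c₀| = 2|c₁|` makes `Λ_{E₁} = c₁Λ₁ = Λ_{E₀} + ℤ·(c₀w/2)` for `[Λ₀:Λ₁] = 2`, and
`Λ₁ = 2Λ₀` is E-an-68's even case; so E-an-152 leaves only `|c₀| = |c₁|`.  Typed as an implication node (nothing asserted). -/
def KernelToLedgerEdge : Prop :=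
  ShimuraKernelBlindAtFour →
  ∀ (W₁ W₀ : WeierstrassCurve ℚ) [W₁.IsElliptic] [W₁.IsGloballyMinimal] [W₀.IsElliptic] [W₀.IsGloballyMinimal]
    {N : ℕ} [NeZero N] (D₁ : Gamma1ParametrizationData W₁ N) (D₀ : ModularParametrizationData W₀ N),
    IsIsogenous W₁ W₀ → D₁.IsOptimal → (∀ z ∈ D₀.L.lattice, ∃ w ∈ periodLattice D₀.f, z = D₀.c * w) →
    2 ^ 2 ∣ N → W₀.a₁ = 0 → W₀.a₃ = 0 →
    ¬ (∀ z : ℂ, z ∈ periodLatticeGamma1 D₁.f ↔ ∃ w ∈ periodLattice D₀.f, z = 2 * w) →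
    D₀.maninConstant.natAbs = D₁.maninConstant.natAbs

/-- **E-an-153 `ShimuraTrivialOfNoBlindAtFour` (the `ℤ/2`-type case of E-an-152, `c`-free and `℘`-free; candidate
LAW, nothing asserted).**  `W₀` globally minimal with `a₁ = a₃ = 0`, `D₀` a lattice-optimal `X₀(N)`-datum, `4 ∣ N`, and NO
rational `2`-torsion point `(E, 0)`, `E ∈ ℤ`, of `W₀` is Kummer-blind: then the Shimura kernel misses `E₀`, i.e.
`Λ₁(f) = Λ₀(f)` («a curve without a blind rational 2-torsion point is its own Stevens curve at 2»).  Under C2 this is forced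
(`[Λ₀:Λ₁] = 4` makes `c₀` even, E-an-68; `= 2` makes the kernel point blind, E-an-152/E-an-54).  Why it might fail: an optimal
`E₀` with `4 ∣ N`, only non-blind rational `2`-torsion and `[Λ₀(f):Λ₁(f)] = 2` (none among 152 such classes with `N ≤ 2000`).
[cite: Stevens1989, §2] [cite: LingOesterle1991, Thm. 6] [cite: CesnaviciusNeururerSaha2023, Lemma 6.5] -/
@[conjecture]
def ShimuraTrivialOfNoBlindAtFour : Prop :=
  ∀ (W₀ : WeierstrassCurve ℚ) [W₀.IsElliptic] [W₀.IsGloballyMinimal] {N : ℕ} [NeZero N]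
    (D₀ : ModularParametrizationData W₀ N),
    (∀ z ∈ D₀.L.lattice, ∃ w ∈ periodLattice D₀.f, z = D₀.c * w) → 2 ^ 2 ∣ N → W₀.a₁ = 0 → W₀.a₃ = 0 →
    (∀ A₂ A₄ E : ℤ, (A₂ : ℚ) = W₀.a₂ → (A₄ : ℚ) = W₀.a₄ →
      (E : ℚ) ^ 3 + W₀.a₂ * (E : ℚ) ^ 2 + W₀.a₄ * E + W₀.a₆ = 0 → ¬ KummerBlindAtTwo A₂ A₄ E) →
    periodLatticeGamma1 D₀.f = periodLattice D₀.f

/-- E-an-153 ⟹ E-an-151 on its locus (index `1` forces `|c₀| = |c₁|`, tree theorem; no fact needed). -/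
theorem transfer_of_shimuraTrivial (h153 : ShimuraTrivialOfNoBlindAtFour)
    {W₁ W₀ : WeierstrassCurve ℚ} [W₁.IsElliptic] [W₁.IsGloballyMinimal] [W₀.IsElliptic] [W₀.IsGloballyMinimal]
    {N : ℕ} [NeZero N] (D₁ : Gamma1ParametrizationData W₁ N) (D₀ : ModularParametrizationData W₀ N)
    (hiso : IsIsogenous W₁ W₀) (h₁ : D₁.IsOptimal)
    (h₀ : ∀ z ∈ D₀.L.lattice, ∃ w ∈ periodLattice D₀.f, z = D₀.c * w) (h4 : 2 ^ 2 ∣ N)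
    (ha₁ : W₀.a₁ = 0) (ha₃ : W₀.a₃ = 0)
    (hnobl : ∀ A₂ A₄ E : ℤ, (A₂ : ℚ) = W₀.a₂ → (A₄ : ℚ) = W₀.a₄ →
      (E : ℚ) ^ 3 + W₀.a₂ * (E : ℚ) ^ 2 + W₀.a₄ * E + W₀.a₆ = 0 → ¬ KummerBlindAtTwo A₂ A₄ E) :
    D₀.maninConstant.natAbs = D₁.maninConstant.natAbs :=
  natAbs_maninConstant₀_eq_of_periodLatticeGamma1_eq_periodLattice D₁ D₀ h₁ h₀ (D₁.f_eq_of_isIsogenous D₀ hiso)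
    (h153 W₀ D₀ h₀ h4 ha₁ ha₃ hnobl)

/-- Hence on the `ℤ/2`-type locus C2 for `D₀` ⟸ E-an-153 ∧ C2¹ for the Stevens datum `D₁` (no fact needed). -/
theorem maninOdd_of_shimuraTrivial_of_gammaOneOdd (h153 : ShimuraTrivialOfNoBlindAtFour)
    {W₁ W₀ : WeierstrassCurve ℚ} [W₁.IsElliptic] [W₁.IsGloballyMinimal] [W₀.IsElliptic] [W₀.IsGloballyMinimal]
    {N : ℕ} [NeZero N] (D₁ : Gamma1ParametrizationData W₁ N) (D₀ : ModularParametrizationData W₀ N)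
    (hiso : IsIsogenous W₁ W₀) (h₁ : D₁.IsOptimal)
    (h₀ : ∀ z ∈ D₀.L.lattice, ∃ w ∈ periodLattice D₀.f, z = D₀.c * w) (h4 : 2 ^ 2 ∣ N)
    (ha₁ : W₀.a₁ = 0) (ha₃ : W₀.a₃ = 0)
    (hnobl : ∀ A₂ A₄ E : ℤ, (A₂ : ℚ) = W₀.a₂ → (A₄ : ℚ) = W₀.a₄ →
      (E : ℚ) ^ 3 + W₀.a₂ * (E : ℚ) ^ 2 + W₀.a₄ * E + W₀.a₆ = 0 → ¬ KummerBlindAtTwo A₂ A₄ E)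
    (hodd₁ : ¬ (2 : ℤ) ∣ D₁.maninConstant) : ¬ (2 : ℤ) ∣ D₀.maninConstant := by
  have he := transfer_of_shimuraTrivial h153 D₁ D₀ hiso h₁ h₀ h4 ha₁ ha₃ hnobl
  rw [← Int.dvd_natAbs, he, Int.dvd_natAbs]; exact hodd₁

/-- **E-an-152b `ShimuraIndexNeFourAtFour` (`c`-free; candidate LAW, nothing asserted): the Shimura kernel never swallows `E₀[2]`** —
for a lattice-optimal `X₀(N)`-datum with `4 ∣ N`, `Λ₁(f) ≠ 2Λ₀(f)` (index `4` is E-an-68's configuration `E₁ = E₀`, `c₀ = ±2c₁`).  Needed beside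
E-an-152 on the mixed locus (E-an-152 is vacuous at index `4`).  Why it might fail: an optimal class with `[Λ₀(f):Λ₁(f)] = 4` beyond the tables
(0/338 in es E15).  [cite: LingOesterle1991, Thm. 6] [cite: Stevens1989, §2] -/
@[conjecture]
def ShimuraIndexNeFourAtFour : Prop :=
  ∀ (W₀ : WeierstrassCurve ℚ) [W₀.IsElliptic] [W₀.IsGloballyMinimal] {N : ℕ} [NeZero N]
    (D₀ : ModularParametrizationData W₀ N),
    (∀ z ∈ D₀.L.lattice, ∃ w ∈ periodLattice D₀.f, z = D₀.c * w) → 2 ^ 2 ∣ N →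
    ¬ (∀ z : ℂ, z ∈ periodLatticeGamma1 D₀.f ↔ ∃ w ∈ periodLattice D₀.f, z = 2 * w)

/-- C2-body ⟹ E-an-152b (E-an-68 `index_ne_four_of_not_two_dvd_maninConstant`, through the Stevens datum supplied by F-need). -/
theorem shimuraIndexNeFour_of_body (hex : exists_optimal_gamma1ParametrizationData) (h : ManinOddAtFourBody) :
    ShimuraIndexNeFourAtFour := by
  intro W₀ _ _ N _ D₀ h₀ h4 hidx
  obtain ⟨W₁, _, _, D₁, hiso, h₁⟩ := hex W₀ D₀ h₀
  have hf : D₁.f = D₀.f := D₁.f_eq_of_isIsogenous D₀ hiso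
  exact index_ne_four_of_not_two_dvd_maninConstant D₁ D₀ h₁ h₀ (h W₀ D₀ h₀ h4) (fun z ↦ by rw [hf]; exact hidx z)

/-- E-an-151 ⟹ E-an-152b (through F-need). -/
theorem shimuraIndexNeFour_of_transfer (hex : exists_optimal_gamma1ParametrizationData) (h151 : GammaOneTransferAtFour) :
    ShimuraIndexNeFourAtFour := by
  intro W₀ _ _ N _ D₀ h₀ h4 hidx
  obtain ⟨W₁, _, _, D₁, hiso, h₁⟩ := hex W₀ D₀ h₀
  have hf : D₁.f = D₀.f := D₁.f_eq_of_isIsogenous D₀ hiso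
  exact index_ne_four_of_transfer h151 D₁ D₀ hiso h₁ h₀ h4 (fun z ↦ by rw [hf]; exact hidx z)

/-- **The mixed-locus assembly:** S-an-65 ∧ E-an-152 ∧ E-an-152b give E-an-151 on every pair with `a₁ = a₃ = 0` (pure logic over the nodes). -/
theorem transfer_of_kernel_rows (h65 : KernelToLedgerEdge) (h152 : ShimuraKernelBlindAtFour) (h152b : ShimuraIndexNeFourAtFour)
    {W₁ W₀ : WeierstrassCurve ℚ} [W₁.IsElliptic] [W₁.IsGloballyMinimal] [W₀.IsElliptic] [W₀.IsGloballyMinimal]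
    {N : ℕ} [NeZero N] (D₁ : Gamma1ParametrizationData W₁ N) (D₀ : ModularParametrizationData W₀ N)
    (hiso : IsIsogenous W₁ W₀) (h₁ : D₁.IsOptimal)
    (h₀ : ∀ z ∈ D₀.L.lattice, ∃ w ∈ periodLattice D₀.f, z = D₀.c * w) (h4 : 2 ^ 2 ∣ N)
    (ha₁ : W₀.a₁ = 0) (ha₃ : W₀.a₃ = 0) :
    D₀.maninConstant.natAbs = D₁.maninConstant.natAbs := by
  have hf : D₁.f = D₀.f := D₁.f_eq_of_isIsogenous D₀ hiso
  exact h65 h152 W₁ W₀ D₁ D₀ hiso h₁ h₀ h4 ha₁ ha₃ (fun hidx ↦ h152b W₀ D₀ h₀ h4 (fun z ↦ by simpa only [hf] using hidx z))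

/-! ## §4 What is already a theorem at index 1 (the locus theorems modulo F★ live in the sibling cone leaf `ShimuraKernelSplit.lean`) -/

/-- E-an-151 at index `1` (`Λ₁(f) = Λ₀(f)`): tree theorem, no fact needed. -/
theorem transfer_of_index_one
    {W₁ W₀ : WeierstrassCurve ℚ} [W₁.IsElliptic] [W₁.IsGloballyMinimal] [W₀.IsElliptic] [W₀.IsGloballyMinimal]
    {N : ℕ} [NeZero N] (D₁ : Gamma1ParametrizationData W₁ N) (D₀ : ModularParametrizationData W₀ N)
    (hiso : IsIsogenous W₁ W₀) (h₁ : D₁.IsOptimal)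
    (h₀ : ∀ z ∈ D₀.L.lattice, ∃ w ∈ periodLattice D₀.f, z = D₀.c * w)
    (hΛ : periodLatticeGamma1 D₀.f = periodLattice D₀.f) :
    D₀.maninConstant.natAbs = D₁.maninConstant.natAbs :=
  natAbs_maninConstant₀_eq_of_periodLatticeGamma1_eq_periodLattice D₁ D₀ h₁ h₀ (D₁.f_eq_of_isIsogenous D₀ hiso) hΛ

end Summit.BirchSwinnertonDyer.Rank1Residual.ManinAdditive.ShimuraKernel

end
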